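import Literature.Probability.Percolation.CriticalContinuity
import Literature.Probability.Percolation.SharpnessDCTProofs
import HarnessLib

/-!
# The shell criterion: uniformly likely disconnection of shells forces `θ = 0`

Solo-blind generation 11, `PercolationContinuityZ3` (target `θ(p_c) = 0` on `ℤ³`).

For `m < M` let `SC(m, M)` (`shellCrossing d m M`) be the event that some site of the sphere
`∂Λ_{m+1} = Λ_{m+1} ∖ Λ_m` is joined to the inner vertex boundary `∂Λ_M` of `Λ_M` by an open path
all of whose sites lie in the closed shell `Λ_M ∖ Λ_m` (`shell d m M`). This file proves, for
Bernoulli bond percolation at ANY density `p` on `ℤ^d`, `d` arbitrary: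

* `siteToBoundary_subset_shellCrossing`: for `ω ⊆ E(ℤ^d)`, `{0 ⟷ ∂Λ_N} ⊆ SC(m, M)` whenever
  `m < M ≤ N` (last visit of the path to `Λ_m`, then first exit from `Λ_M`);
* `determinedBy_shellCrossing`: `SC(m, M)` is determined by the pairs of sites of the shell, so
  crossings of vertex-disjoint shells are independent (`real_shellCrossings_le`: for shells
  `m_k < M_k ≤ m_{k+1}` with `P_p(SC(m_k, M_k)ᶜ) ≥ c` for all `k`,
  `P_p(⋂_{k<K} SC(m_k, M_k)) ≤ (1 - c)^K`);
* `real_siteToBoundary_le_pow_of_shells`: hence `P_p(0 ⟷ ∂Λ_{M_K}) ≤ (1 - c)^K`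
  (a polynomial one-arm bound when `M_k` grows geometrically), and
* `theta_eq_zero_of_shells`: `θ(p) = 0`.

Specialised to the shells `n ≤ ‖x‖_∞ ≤ 2n` at `p = p_c` (`percolationContinuity_of_annuli`,
`percolationContinuityZ3_of_annuli`): IF there is `c > 0` with
`P_{p_c}(∂Λ_n ⟷̸ ∂Λ_{2n} inside Λ_{2n} ∖ Λ_{n-1}) ≥ c` for every `n ≥ 1`, THEN `θ(p_c) = 0`.

Reading. The hypothesis is the three-dimensional analogue of the Russo–Seymour–Welsh lower bound
for closed dual circuits in annuli. By Harris–FKG gluing of the six slab-shaped pieces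
`[-2n, 2n]² × [n, 2n]`, … of the annulus it follows from the postulate of
Borgs–Chayes–Kesten–Spencer (1999) that at `p_c` the crossing probabilities of cuboids of fixed
shape (here `4 : 4 : 1`, crossed the thin way) stay bounded away from `1` — the "upper half" of a
box-crossing property for `ℤ³`, expected to hold exactly below the upper critical dimension
(Bollobás–Riordan 2006, Ch. 7, discussion of the hyperscaling relations). It is NOT known on `ℤ³`,
and this file does not claim it: the theorems are the kernel-checked form of the implication
"annulus disconnection bounded below at `p_c` ⟹ `θ(p_c) = 0`", a criterion living at the critical
point itself (no supercritical input, no comparison between two values of `p`), complementing the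
half-space and equicontinuity criteria formalised by earlier generations of this seat.

References: G. Grimmett, Percolation (2nd ed., 1999), §1.4 (`θ(p) ≤ P_p(0 ⟷ ∂B(n))`), §2.2
(events on disjoint edge sets are independent), §11.7 (RSW in two dimensions);
C. Borgs, J. T. Chayes, H. Kesten, J. Spencer, "Uniform boundedness of critical crossing
probabilities implies hyperscaling", Random Structures Algorithms 15 (1999), 368–413, and
B. Bollobás, O. Riordan, Percolation (2006), Ch. 7 (context for the hypothesis only).
Tree inputs: `DCT16.theta_le_real_siteToBoundary`, `DCT16.real_inter_of_determinedBy_disjoint`,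
`PathIn.last_exit`, `PathIn.exit_or`.
-/

namespace Summit.CriticalPhenomena.PercolationContinuityZ3.Theorems

open MeasureTheory ProbabilityTheory Filter Topology
open Literature.Probability.LatticeModels Literature.Probability.Percolation
open Literature.Probability.Percolation.DCT16

variable {d : ℕ}

/-! ### Shells and the shell-crossing event -/

/-- The closed shell `Λ_M ∖ Λ_m = {x : m < ‖x‖_∞ ≤ M}`. -/
noncomputable def shell (d m M : ℕ) : Finset (Site d) := box d M \ box d m

/-- Membership in the shell. -/
theorem mem_shell {m M : ℕ} {x : Site d} : x ∈ shell d m M ↔ x ∈ box d M ∧ x ∉ box d m :=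
  Finset.mem_sdiff

/-- **The shell-crossing event** `SC(m, M)`: some site of the sphere `Λ_{m+1} ∖ Λ_m` is joined to a
site of `∂Λ_M` by an open path inside the shell `Λ_M ∖ Λ_m`. -/
def shellCrossing (d m M : ℕ) : Set (BondConfig (Site d)) :=
  ⋃ x ∈ shell d m (m + 1), ⋃ y ∈ innerBoundary (zdGraph d) (box d M),
    openConnIn (↑(shell d m M) : Set (Site d)) x y

/-- Membership in `shellCrossing`, in terms of open paths. -/
theorem mem_shellCrossing {m M : ℕ} {ω : BondConfig (Site d)} :
    ω ∈ shellCrossing d m M ↔ ∃ x ∈ shell d m (m + 1), ∃ y ∈ innerBoundary (zdGraph d) (box d M),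
      PathIn (openGraph ω) (↑(shell d m M) : Set (Site d)) x y := by
  simp only [shellCrossing, Set.mem_iUnion, exists_prop, mem_openConnIn_iff_pathIn]

/-- `SC(m, M)` is determined by the pairs of sites of the shell `Λ_M ∖ Λ_m`. -/
theorem determinedBy_shellCrossing (d m M : ℕ) :
    DeterminedBy (shellCrossing d m M) (↑((shell d m M).sym2) : Set (Sym2 (Site d))) :=
  DeterminedBy.iUnion fun x => DeterminedBy.iUnion fun _ => DeterminedBy.iUnion fun y =>
    DeterminedBy.iUnion fun _ => determinedBy_openConnIn _ x y (by rw [Finset.coe_sym2])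

/-- `SC(m, M)` is measurable. -/
theorem measurableSet_shellCrossing (d m M : ℕ) : MeasurableSet (shellCrossing d m M) :=
  (determinedBy_shellCrossing d m M).measurableSet_of_finset

/-! ### `{0 ⟷ ∂Λ_N}` crosses every shell `Λ_M ∖ Λ_m` with `m < M ≤ N` -/

/-- **An arm to distance `N` crosses every intermediate shell.** For `ω ⊆ E(ℤ^d)` and
`m < M ≤ N`, an open path from `0` to `∂Λ_N` inside `Λ_N` contains, after its last visit to `Λ_m`,
an open path inside `Λ_M ∖ Λ_m` from a site of `Λ_{m+1} ∖ Λ_m` to a site of `∂Λ_M` (stop at the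
first exit from `Λ_M`, or at the endpoint if `M = N`). -/
theorem siteToBoundary_subset_shellCrossing {m M N : ℕ} (hmM : m < M) (hMN : M ≤ N)
    {ω : BondConfig (Site d)} (hω : ω ⊆ (zdGraph d).edgeSet) (h : ω ∈ siteToBoundary d N) :
    ω ∈ shellCrossing d m M := by
  rw [mem_siteToBoundary_iff] at h
  obtain ⟨z, hz, hpath⟩ := h
  have hzm : z ∉ (↑(box d m) : Set (Site d)) := fun hz' =>
    notMem_box_of_mem_innerBoundary_box (lt_of_lt_of_le hmM hMN) hz (Finset.mem_coe.1 hz')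
  -- last visit to `Λ_m`
  obtain ⟨a, b, ha, -, hb, hab, hp⟩ :=
    hpath.last_exit (C := (↑(box d m) : Set (Site d))) (Finset.mem_coe.2 (zero_mem_box d m)) hzm
  have hb1 : b ∈ box d (m + 1) := mem_box_succ_of_adj (Finset.mem_coe.1 ha) (adj_of_openGraph_adj hω hab)
  have hbshell : b ∈ shell d m (m + 1) := mem_shell.2 ⟨hb1, fun h => hb (Finset.mem_coe.2 h)⟩
  have hbM : b ∈ (↑(box d M) : Set (Site d)) := Finset.mem_coe.2 (box_mono d hmM hb1)
  -- the set in which the remaining path runs, intersected with `Λ_M`, is inside the shell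
  have hsub : (↑(box d M) : Set (Site d)) ∩ ((↑(box d N) : Set (Site d)) \ ↑(box d m)) ⊆
      (↑(shell d m M) : Set (Site d)) := by
    rintro x ⟨hxM, -, hxm⟩
    exact Finset.mem_coe.2 (mem_shell.2 ⟨Finset.mem_coe.1 hxM, fun h => hxm (Finset.mem_coe.2 h)⟩)
  rw [mem_shellCrossing]
  -- first exit from `Λ_M`
  rcases hp.exit_or hbM with hp' | ⟨a', b', ha', hb', -, hab', hp'⟩
  · -- the path never leaves `Λ_M`: then `M = N` in effect, and `z ∈ ∂Λ_M`
    have hzM : z ∈ box d M := Finset.mem_coe.1 hp'.right_mem.1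
    obtain ⟨i, hi⟩ := exists_natAbs_eq_of_mem_innerBoundary_box hz
    have hzi : (z i).natAbs = M := by
      have h1 := (mem_box.1 hzM) i
      omega
    exact ⟨b, hbshell, z, mem_innerBoundary_box_of_natAbs_eq hzM hzi, hp'.mono hsub⟩
  · refine ⟨b, hbshell, a', ?_, hp'.mono hsub⟩
    rw [mem_innerBoundary_iff]
    exact ⟨Finset.mem_coe.1 ha', b', fun h => hb' (Finset.mem_coe.2 h), adj_of_openGraph_adj hω hab'⟩

/-! ### Independence of the crossings of disjoint shells -/

/-- Pairs of sites of disjoint finite sets are disjoint. -/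
theorem disjoint_sym2 {α : Type*} {s t : Finset α} (h : Disjoint s t) : Disjoint s.sym2 t.sym2 :=
  Finset.disjoint_left.2 (Sym2.ind (fun _ _ ha hb =>
    Finset.disjoint_left.1 h (Finset.mk_mem_sym2_iff.1 ha).1 (Finset.mk_mem_sym2_iff.1 hb).1))

/-- Shells `Λ_{M} ∖ Λ_{m}` and `Λ_{M'} ∖ Λ_{m'}` with `M ≤ m'` are disjoint. -/
theorem disjoint_shell {m M m' M' : ℕ} (h : M ≤ m') : Disjoint (shell d m M) (shell d m' M') :=
  Finset.disjoint_left.2 fun _ hx hx' => (mem_shell.1 hx').2 (box_mono d h (mem_shell.1 hx).1)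

/-- For a sequence of shells `m_k < M_k ≤ m_{k+1}`, the outer radii increase. -/
theorem strictMono_of_shells {m M : ℕ → ℕ} (hmM : ∀ k, m k < M k) (hMm : ∀ k, M k ≤ m (k + 1)) :
    StrictMono M :=
  strictMono_nat_of_lt_succ fun k => lt_of_le_of_lt (hMm k) (hmM (k + 1))

/-- For a sequence of shells `m_k < M_k ≤ m_{k+1}`, `M_k ≤ m_l` whenever `k < l`. -/
theorem outer_le_inner_of_lt {m M : ℕ → ℕ} (hmM : ∀ k, m k < M k) (hMm : ∀ k, M k ≤ m (k + 1))
    {k l : ℕ} (hkl : k < l) : M k ≤ m l := by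
  induction l with
  | zero => exact absurd hkl (Nat.not_lt_zero k)
  | succ l ih =>
    rcases Nat.lt_succ_iff_lt_or_eq.1 hkl with hkl' | rfl
    · exact (ih hkl').trans ((hmM l).le.trans (hMm l))
    · exact hMm k

/-- **Independent shells multiply.** If the shells `Λ_{M_k} ∖ Λ_{m_k}` are successively nested
(`m_k < M_k ≤ m_{k+1}`) and each fails to be crossed with probability at least `c`, then
`P_p(⋂_{k<K} SC(m_k, M_k)) ≤ (1 - c)^K` (Grimmett 1999, §2.2: events determined by disjoint edge
sets are independent). -/
theorem real_shellCrossings_le (p : unitInterval) {c : ℝ} {m M : ℕ → ℕ}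
    (hmM : ∀ k, m k < M k) (hMm : ∀ k, M k ≤ m (k + 1))
    (h : ∀ k, c ≤ (bondPercolation (zdGraph d) p).real (shellCrossing d (m k) (M k))ᶜ) (K : ℕ) :
    (bondPercolation (zdGraph d) p).real (⋂ k ∈ Finset.range K, shellCrossing d (m k) (M k)) ≤
      (1 - c) ^ K := by
  classical
  -- each crossing has probability at most `1 - c`
  have hle : ∀ k, (bondPercolation (zdGraph d) p).real (shellCrossing d (m k) (M k)) ≤ 1 - c := by
    intro k
    have := measureReal_compl (μ := bondPercolation (zdGraph d) p) (measurableSet_shellCrossing d (m k) (M k))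
    rw [probReal_univ] at this
    linarith [h k]
  -- the intersection of the first `K` crossings is determined by the pairs of the first `K` shells
  have hdet : ∀ K, DeterminedBy (⋂ k ∈ Finset.range K, shellCrossing d (m k) (M k))
      (↑((Finset.range K).biUnion fun k => (shell d (m k) (M k)).sym2) : Set (Sym2 (Site d))) := by
    intro K
    refine DeterminedBy.iInter fun k => DeterminedBy.iInter fun hk => ?_
    exact (determinedBy_shellCrossing d (m k) (M k)).mono (Finset.coe_subset.2
      (Finset.subset_biUnion_of_mem (fun k => (shell d (m k) (M k)).sym2) hk))
  induction K with
  | zero => simp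
  | succ K ih =>
    have hdisj : Disjoint (shell d (m K) (M K)).sym2
        ((Finset.range K).biUnion fun k => (shell d (m k) (M k)).sym2) := by
      rw [Finset.disjoint_biUnion_right]
      intro k hk
      exact disjoint_sym2 (disjoint_shell (outer_le_inner_of_lt hmM hMm (Finset.mem_range.1 hk))).symm
    rw [Finset.range_add_one, Finset.set_biInter_insert,
      real_inter_of_determinedBy_disjoint (zdGraph d) p (determinedBy_shellCrossing d (m K) (M K))
        (hdet K) hdisj, pow_succ, mul_comm]
    exact mul_le_mul ih (hle K) measureReal_nonneg (le_trans measureReal_nonneg ih)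

/-! ### Consequences: one-arm decay and `θ = 0` -/

/-- **One-arm bound from shells**: under the hypotheses of `real_shellCrossings_le`,
`P_p(0 ⟷ ∂Λ_{M_K}) ≤ (1 - c)^K` — an arm to `∂Λ_{M_K}` crosses the `K` disjoint shells
`Λ_{M_k} ∖ Λ_{m_k}`, `k < K`. -/
theorem real_siteToBoundary_le_pow_of_shells (p : unitInterval) {c : ℝ} {m M : ℕ → ℕ}
    (hmM : ∀ k, m k < M k) (hMm : ∀ k, M k ≤ m (k + 1))
    (h : ∀ k, c ≤ (bondPercolation (zdGraph d) p).real (shellCrossing d (m k) (M k))ᶜ) (K : ℕ) :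
    (bondPercolation (zdGraph d) p).real (siteToBoundary d (M K)) ≤ (1 - c) ^ K := by
  refine le_trans (real_mono_of_forall_subset_edgeSet (zdGraph d) p fun ω hω hωN => ?_)
    (real_shellCrossings_le p hmM hMm h K)
  simp only [Set.mem_iInter]
  intro k hk
  exact siteToBoundary_subset_shellCrossing (hmM k)
    ((strictMono_of_shells hmM hMm).monotone (Finset.mem_range.1 hk).le) hω hωN

/-- **The shell criterion.** If along a sequence of successively nested shells
`Λ_{M_k} ∖ Λ_{m_k}` (`m_k < M_k ≤ m_{k+1}`) the probability that the shell is NOT crossed by an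
open path stays above some `c > 0`, then `θ(p) = 0`: `θ(p) ≤ P_p(0 ⟷ ∂Λ_{M_K}) ≤ (1 - c)^K → 0`. -/
theorem theta_eq_zero_of_shells (p : unitInterval) {c : ℝ} (hc : 0 < c) {m M : ℕ → ℕ}
    (hmM : ∀ k, m k < M k) (hMm : ∀ k, M k ≤ m (k + 1))
    (h : ∀ k, c ≤ (bondPercolation (zdGraph d) p).real (shellCrossing d (m k) (M k))ᶜ) :
    theta (zdGraph d) 0 p = 0 := by
  have hc1 : c ≤ 1 := (h 0).trans measureReal_le_one
  have hθK : ∀ K, theta (zdGraph d) 0 p ≤ (1 - c) ^ K := fun K =>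
    (theta_le_real_siteToBoundary p (M K)).trans (real_siteToBoundary_le_pow_of_shells p hmM hMm h K)
  have hlim : Tendsto (fun K : ℕ => (1 - c) ^ K) atTop (𝓝 0) :=
    tendsto_pow_atTop_nhds_zero_of_lt_one (by linarith) (by linarith)
  refine le_antisymm ?_ ?_
  · exact le_of_tendsto_of_tendsto' tendsto_const_nhds hlim hθK
  · unfold theta; exact measureReal_nonneg

/-! ### The annuli `n ≤ ‖x‖_∞ ≤ 2n` at the critical point -/

/-- **Continuity from annulus disconnection.** If there is `c > 0` such that for every `n ≥ 1`,
with `P_{p_c}`-probability at least `c` NO site of the sphere `‖x‖_∞ = n` is joined to the sphere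
`‖x‖_∞ = 2n` by an open path inside the annulus `n ≤ ‖x‖_∞ ≤ 2n`, then `θ(p_c) = 0` on `ℤ^d`
(use the disjoint annuli at scales `n = 3^k`). -/
theorem percolationContinuity_of_annuli {c : ℝ} (hc : 0 < c)
    (h : ∀ n, 1 ≤ n →
      c ≤ (bondPercolation (zdGraph d) (criticalProbI d)).real (shellCrossing d (n - 1) (2 * n))ᶜ) :
    PercolationContinuity d := by
  refine theta_eq_zero_of_shells (criticalProbI d) hc (m := fun k => 3 ^ k - 1)
    (M := fun k => 2 * 3 ^ k) (fun k => ?_) (fun k => ?_) (fun k => h (3 ^ k) (Nat.one_le_pow _ _ (by norm_num)))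
  · show 3 ^ k - 1 < 2 * 3 ^ k
    have h3 := Nat.one_le_pow k 3 (by norm_num)
    generalize 3 ^ k = t at h3 ⊢
    omega
  · show 2 * 3 ^ k ≤ 3 ^ (k + 1) - 1
    have h3 := Nat.one_le_pow k 3 (by norm_num)
    rw [pow_succ]
    generalize 3 ^ k = t at h3 ⊢
    omega

/-- **`θ(p_c) = 0` on `ℤ³` from annulus disconnection**: the case `d = 3` of
`percolationContinuity_of_annuli`. -/
theorem percolationContinuityZ3_of_annuli {c : ℝ} (hc : 0 < c)
    (h : ∀ n, 1 ≤ n →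
      c ≤ (bondPercolation (zdGraph 3) (criticalProbI 3)).real (shellCrossing 3 (n - 1) (2 * n))ᶜ) :
    PercolationContinuityZ3 :=
  percolationContinuity_of_annuli hc h

end Summit.CriticalPhenomena.PercolationContinuityZ3.Theorems
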